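import Summits.Ventures.Crystal3D.Theorems.StickyWulffConstantTextureBuildMeshV3
import HarnessLib

/-!
# TB-1: the LABELLED POLYHEDRAL MESH v4 = v3 + two COVER-SIDE facts the texture assembly needs (presentations aligned; agreement frame witness)
# (lane T, crux `TextureLiminfV5`, stmt-Ventures-23912; design memo HOME/wulff-p2/g19/TB-D-0.md §8 (F4)/(F5); bus 2026-08-29T09:5xZ)

HONEST FRAMING. Venture `Summits/Ventures/Crystal3D` (cell `crystal3d-full`), route `route-Ventures-StickyWulffConstant`, helper `--supports` the
law-v5 crux `TextureLiminfV5` (stmt-Ventures-23912).  DEFINITIONS (interface v4 = v3 + 3 `Prop` fields) + the level-2 composition re-typed (pure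
logic; census-free, standard axioms).  No mesh is constructed, no texture is built; rung F-C1 not moved.

WHY v4.  Typing the texture assembly (`energy_le_pieceLedger`, …TextureBuildPieceEnergy; TB-D-0 §7–§8) over `Mesh₃` exposed two facts that only
the COVER can supply and that cost it nothing:
* `hpres₁/hpres₂` — the placed model presentation of each wall cell's plate IS the tent's presentation of that grain (same frame, origin and
  Hägg word), not merely the same point set (`Mesh₃.hS₁/hS₂`): then the cell's layer slabs, which index its law table `c i j` and its `charge`, are
  literally the slab grains of the texture; without it an fcc grain's cell could be layered along another `⟨111⟩` than its tent.
* `hagreeFr` — every AGREEMENT contact of two territories (the stackings coincide on a ball, `Mesh₃.hagree`) comes with a frame witness: the two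
  tents' axes are parallel, or the common material on the ball lies in ONE affine fcc lattice (the tilted case is locally fcc and the resolution
  knows it).  With …TextureBuildPatchRigidity this makes the two slab grains' frame lattices equal, so the law charges `0` there.
Everything else (fields, `gapCost`, the slack composition) is inherited from `Mesh₃` through `toMesh₃`.
-/

noncomputable section

open scoped BigOperators InnerProductSpace
open MeasureTheory

namespace Summit.Ventures.Crystal3D.Cruxes.TextureLiminf.TexShadow

open Summit.Ventures.Crystal3D Summit.Ventures.Crystal3D.Theorems

/-- **The labelled polyhedral mesh, v4**: `Mesh₃` + aligned cell presentations + agreement frame witnesses. -/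
structure Mesh₄ {C R₀ : ℝ} {N : ℕ} {x : Fin N → E3} (rc : RiseredCover C R₀ N x) (δ : ℝ) extends Mesh₃ rc δ where
  /-- plate 1 of cell `k`, placed, is presented EXACTLY as the tent of grain `fk k` -/
  hpres₁ : ∀ k, (∀ r : E3, rigid (rc.cell k).M (rc.cell k).t ((rc.cell k).L₁ r + (rc.cell k).s₁) =
      (rc.tent (fk k)).L r + (rc.tent (fk k)).s) ∧ (rc.cell k).σ₁ = (rc.tent (fk k)).σ
  /-- plate 2 of cell `k`, placed, is presented EXACTLY as the tent of grain `gk k` -/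
  hpres₂ : ∀ k, (∀ r : E3, rigid (rc.cell k).M (rc.cell k).t ((rc.cell k).L₂ r + (rc.cell k).s₂) =
      (rc.tent (gk k)).L r + (rc.tent (gk k)).s) ∧ (rc.cell k).σ₂ = (rc.tent (gk k)).σ
  /-- agreement contacts carry a frame witness: parallel axes, or one affine fcc lattice containing the common material on the ball -/
  hagreeFr : ∀ f g, f ≠ g → ∀ y ∈ closure (⋃ j, polytope (HD f j)) ∩ closure (⋃ j, polytope (HD g j)),
    ∃ r : ℝ, 0 < r ∧ rc.S f ∩ Metric.ball y (r + 4) = rc.S g ∩ Metric.ball y (r + 4) ∧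
      (((rc.tent f).L e₃ = (rc.tent g).L e₃ ∨ (rc.tent f).L e₃ = -(rc.tent g).L e₃) ∨
        ∃ (A : E3 ≃ₗᵢ[ℝ] E3) (u : E3), rc.S f ∩ Metric.ball y (r + 4) ⊆ (fun q => A q + u) '' fccRef)
  /-- the same witness for the cross-grain matches of territory frontiers and gap facets (`hbdry` / `hQmatch` agreement disjuncts) -/
  hmatchFr : ∀ f g, f ≠ g → ∀ z ∈ closure (⋃ j, polytope (HD g j)), ∀ r' : ℝ, 0 < r' →
    rc.S f ∩ Metric.ball z (r' + 4) = rc.S g ∩ Metric.ball z (r' + 4) →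
      (((rc.tent f).L e₃ = (rc.tent g).L e₃ ∨ (rc.tent f).L e₃ = -(rc.tent g).L e₃) ∨
        ∃ (A : E3 ≃ₗᵢ[ℝ] E3) (u : E3), rc.S f ∩ Metric.ball z (r' + 4) ⊆ (fun q => A q + u) '' fccRef)

namespace Mesh₄

variable {C R₀ : ℝ} {N : ℕ} {x : Fin N → E3} {rc : RiseredCover C R₀ N x} {δ : ℝ}

/-- the gap cost (inherited from v3) -/
def gapCost (μ : Mesh₄ rc δ) : ℝ := μ.toMesh₃.gapCost

/-- `gapCost` is that of the underlying v3 mesh. -/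
theorem gapCost_eq (μ : Mesh₄ rc δ) : μ.gapCost = μ.toMesh₃.gapCost := rfl

end Mesh₄

/-! ## The level-2 composition of record (mesh v4, slack form) -/

/-- **THE LEVEL-2 COMPOSITION over risered cover + mesh v4, WITH SLACK** (adhesion hypothesis arbitrary): «TB-cover v4» + «TB-energy v4» + the wall law
⇒ the atomic-scale saturated shadow theorem. -/
theorem shadowTheoremSatAtomicV5_of_risered₄_slack {Adh : Prop}
    (hcover : BarlowResolution → Adh →
      ∀ C R₀ : ℝ, 1 ≤ R₀ → ∀ K δ θ : ℝ, 0 < δ → 0 < θ → ∃ N₀ : ℕ, ∀ N : ℕ, N₀ ≤ N → ∀ x : Fin N → E3, IsUnitPacking x →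
        IsSaturated x → 6 * (N : ℝ) - (numContacts x : ℝ) ≤ K * (N : ℝ) ^ ((2 : ℝ) / 3) →
        ∃ (rc : RiseredCover C R₀ N x) (μ : Mesh₄ rc δ),
          rc.tilingLoss₂ + rc.rimSum + μ.gapCost ≤ θ * (N : ℝ) ^ ((2 : ℝ) / 3) + rc.unownedSlack₃)
    (henergy : PolytopeCalculus → BarlowFreeCertificate →
      ∀ (C R₀ : ℝ) (N : ℕ) (x : Fin N → E3) (δ : ℝ) (rc : RiseredCover C R₀ N x) (μ : Mesh₄ rc δ),
        ∃ (n : ℕ) (G : Fin n → Set E3) (A : Fin n → (E3 ≃ₗᵢ[ℝ] E3)) (c : Fin n → Fin n → ℝ) (m : Fin n → Fin n → E3),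
          IsTexture (13 / 25) (1 / 2) n G A c m ∧ (1 - δ) * (N : ℝ) ≤ Real.sqrt 2 * vol n G ∧
          energy n G A c m ≤ rc.tentBudget + rc.chargeSum + rc.riserSum + μ.gapCost) :
    BarlowResolution → Adh → BilayerWallV5 → PolytopeCalculus → BarlowFreeCertificate → ShadowTheoremSatAtomicV5 := by
  intro hres hadh hBW hpoly hfree _hG _hC _hNRG _hSL K δ θ hδ hθ
  obtain ⟨C, R₀, hR₀, hW⟩ := hBW
  obtain ⟨N₀, hN₀⟩ := hcover hres hadh C R₀ hR₀ K δ θ hδ hθ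
  refine ⟨N₀, fun N hN x hx hsat hK => ?_⟩
  obtain ⟨rc, μ, hslack⟩ := hN₀ N hN x hx hsat hK
  obtain ⟨n, G, A, c, m, hT, hvol, hEn⟩ := henergy hpoly hfree C R₀ N x δ rc μ
  refine ⟨n, G, A, c, m, hT, hvol, ?_⟩
  have hdisc := rc.tentBudget_add_chargeSum_le₃_slack hR₀ hW
  linarith

/-- **THE v8.8 COMPOSITION OF RECORD (mesh v4)**: TB-cover v4 + TB-energy v4 ⇒ the registered shape of `stub_textureBuild` (adhesion `BarlowAdhesionT`). -/
theorem textureBuildR₄_of_stubs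
    (hcover : BarlowResolution → BarlowAdhesionT →
      ∀ C R₀ : ℝ, 1 ≤ R₀ → ∀ K δ θ : ℝ, 0 < δ → 0 < θ → ∃ N₀ : ℕ, ∀ N : ℕ, N₀ ≤ N → ∀ x : Fin N → E3, IsUnitPacking x →
        IsSaturated x → 6 * (N : ℝ) - (numContacts x : ℝ) ≤ K * (N : ℝ) ^ ((2 : ℝ) / 3) →
        ∃ (rc : RiseredCover C R₀ N x) (μ : Mesh₄ rc δ),
          rc.tilingLoss₂ + rc.rimSum + μ.gapCost ≤ θ * (N : ℝ) ^ ((2 : ℝ) / 3) + rc.unownedSlack₃)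
    (henergy : PolytopeCalculus → BarlowFreeCertificate →
      ∀ (C R₀ : ℝ) (N : ℕ) (x : Fin N → E3) (δ : ℝ) (rc : RiseredCover C R₀ N x) (μ : Mesh₄ rc δ),
        ∃ (n : ℕ) (G : Fin n → Set E3) (A : Fin n → (E3 ≃ₗᵢ[ℝ] E3)) (c : Fin n → Fin n → ℝ) (m : Fin n → Fin n → E3),
          IsTexture (13 / 25) (1 / 2) n G A c m ∧ (1 - δ) * (N : ℝ) ≤ Real.sqrt 2 * vol n G ∧
          energy n G A c m ≤ rc.tentBudget + rc.chargeSum + rc.riserSum + μ.gapCost) :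
    BarlowResolution → BarlowAdhesionT → BilayerWallV5 → PolytopeCalculus → BarlowFreeCertificate → ShadowTheoremSatV5 :=
  textureBuild_of_atomic (shadowTheoremSatAtomicV5_of_risered₄_slack hcover henergy)

end Summit.Ventures.Crystal3D.Cruxes.TextureLiminf.TexShadow

end
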